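import Literature.AlgebraicGeometry.Resolution.AffineBlowupUniversal
import Literature.AlgebraicGeometry.Resolution.BlowupsGlue
import Literature.AlgebraicGeometry.Resolution.BlowupsFacts
import Mathlib.AlgebraicGeometry.RelativeGluing
import HarnessLib

/-!
# Existence of blowing ups (Görtz–Wedhorn I, Prop. 13.92; Stacks 01OG) — `Stacks01OG` discharged

Topic: `Literature/AlgebraicGeometry/Resolution`. PROVED over Mathlib: **every ideal sheaf `J` on
every scheme `X` admits a blowing up** `π : X' → X` (`IsBlowup π J`, the universal property of
Görtz–Wedhorn I, Def. 13.90), which DISCHARGES the named fact `Stacks01OG` of `BlowupsFacts.lean`.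
Proof as printed in Görtz–Wedhorn for Prop. 13.92 ("This can be checked locally on `X`. Thus we
assume that `X = Spec A` is affine"): over each affine open `U ⊆ X` the affine construction
`Bl(U) = Proj ⨁ I(U)^d → U` is a blowing up (`exists_isBlowup_of_isAffine`,
`AffineBlowupUniversal.lean`); for `U ⊆ V` the morphism `Bl(U) → Bl(V)` provided by the
universal property (GW Prop. 13.91 (1)) makes `Bl(U)` the preimage of `U` (GW Prop. 13.91 (2) for
the open immersion `U ↪ V`: `IsBlowup.isPullback_of_isOpenImmersion`), so the `Bl(U)` form a
relative gluing datum over the locally directed cover of `X` by its affine opens and glue to a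
scheme `X' → X` whose restriction over each `U` is `Bl(U)` (Mathlib's
`Scheme.Cover.RelativeGluingData`, Stacks 01LH); being a blowing up is local on the base
(`IsBlowup.of_openCover`, `BlowupsGlue.lean`).

* `IsBlowup.isPullback_of_isOpenImmersion` — GW Prop. 13.91 (2) for open immersions `ι : U → V`:
  a blowing up of `U` along `J|_U` maps to the blowing up of `V` along `J` by a cartesian square;
* `IsBlowup.toBase_of_relativeGluingData` — blowing ups of the affine opens forming a relative
  gluing datum glue to a blowing up;
* `exists_isBlowup` — **existence of blowing ups** for all schemes and ideal sheaves;
* `stacks01OG_holds : Stacks01OG` — the named fact DISCHARGED (also as `Stacks01OG_holds`, the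
  conventional `X_holds` name).

## Sources

* U. Görtz, T. Wedhorn, *Algebraic Geometry I: Schemes*, 2nd ed. (2020), (13.19): Def. 13.90,
  Prop. 13.91 (1), (2) (p. 414), Prop. 13.92 and its proof (p. 415: "This can be checked locally
  on `X`").
* The Stacks Project, Tag 01OG (Def. 31.32.1), Tag 0806 (Lemma 31.32.5), Tag 01LH (relative
  gluing).
-/

noncomputable section

open CategoryTheory CategoryTheory.Limits AlgebraicGeometry TopologicalSpace

namespace Literature.AlgebraicGeometry.Resolution

universe u

/-- **Görtz–Wedhorn I, Prop. 13.91 (2) for open immersions**: if `πV : BV → V` is a blowing up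
of `V` along `J`, `ι : U → V` an open immersion, `πU : BU → U` a blowing up of `U` along `ι⁻¹ J`
and `t : BU → BV` a morphism over `ι` (the morphism `Bl(ι)` of Prop. 13.91 (1)), then the square
`(t, πU, πV, ι)` is cartesian: `πV` restricted over the open `ι(U)` is a blowing up of it
(`IsBlowup.restrict`), hence isomorphic to `BU` over `U` (uniqueness of blowing ups), and `t` is
that isomorphism followed by the inclusion `πV⁻¹(ι(U)) ↪ BV` (uniqueness of morphisms to a
blowing up). [cite: GortzWedhorn2020, Prop. 13.91 (2)] -/
theorem IsBlowup.isPullback_of_isOpenImmersion {U V BU BV : Scheme.{u}} {J : V.IdealSheafData}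
    {πV : BV ⟶ V} (hV : IsBlowup πV J) (ι : U ⟶ V) [IsOpenImmersion ι] {πU : BU ⟶ U}
    (hU : IsBlowup πU (J.comap ι)) {t : BU ⟶ BV} (ht : t ≫ πV = πU ≫ ι) :
    IsPullback t πU πV ι := by
  -- the open `W = ι(U)` of `V` and `U ≅ W`
  let W : V.Opens := Scheme.Hom.opensRange ι
  let e : U ≅ (W : Scheme.{u}) := Scheme.Hom.isoOpensRange ι
  have he : e.hom ≫ W.ι = ι := Scheme.Hom.isoOpensRange_hom_ι ι
  have he' : e.inv ≫ ι = W.ι := Scheme.Hom.isoOpensRange_inv_comp ι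
  -- both `πV ∣_ W` and `πU ≫ e.hom` are blowing ups of `W` along `J|_W`
  have h1 : IsBlowup (πV ∣_ W) (J.comap W.ι) := hV.restrict W
  have h2 : IsBlowup (πU ≫ e.hom) (J.comap W.ι) := by
    have := hU.comp_iso e
    rwa [← Scheme.IdealSheafData.comap_comp, he'] at this
  obtain ⟨f, hf, -⟩ := h2.unique h1
  -- the open immersion `t' = f ≫ (πV⁻¹ W ↪ BV)` coincides with `t`
  have ht' : (f.hom ≫ (πV ⁻¹ᵁ W).ι) ≫ πV = πU ≫ ι := by
    rw [Category.assoc, ← morphismRestrict_ι, ← Category.assoc, hf, Category.assoc, he]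
  have htt' : t = f.hom ≫ (πV ⁻¹ᵁ W).ι := by
    refine hV.hom_ext ?_ (ht.trans ht'.symm)
    rw [ht, Scheme.IdealSheafData.comap_comp]
    exact hU.isEffectiveCartier
  -- `t'` exhibits `BU` as `πV⁻¹(ι(U))`
  have hsq : IsPullback πU (f.hom ≫ (πV ⁻¹ᵁ W).ι) ι πV := by
    refine IsOpenImmersion.isPullback πU (f.hom ≫ (πV ⁻¹ᵁ W).ι) ι πV ht' ?_
    apply le_antisymm
    · intro x hx
      refine ⟨f.inv ⟨x, hx⟩, ?_⟩
      rw [← Scheme.Hom.comp_apply, f.inv_hom_id_assoc]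
      rfl
    · rintro _ ⟨y, rfl⟩
      rw [Scheme.Hom.comp_apply]
      exact (f.hom y).2
  rw [htt']
  exact hsq.flip

/-- **Gluing blowing ups over the affine opens** (the reduction "this can be checked locally on
`X`" in Görtz–Wedhorn's proof of Prop. 13.92, via relative gluing, Stacks 01LH): if a relative
gluing datum `d` over the locally directed cover of `X` by its affine opens consists of blowing
ups `d_U : X'_U → U` of `U` along `J|_U`, then the glued morphism `d.toBase : X' → X` is a blowing
up of `X` along `J` — its restriction over `U` is isomorphic to `d_U` (both squares
`X'_U → X' → X ← U` and `toBase⁻¹(U) → X' → X ← U` are cartesian, Mathlib's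
`RelativeGluingData.isPullback_natTrans_ι_toBase` and `isPullback_morphismRestrict`), and being a
blowing up is local on the base (`IsBlowup.of_openCover`).
[cite: GortzWedhorn2020, Prop. 13.92 (proof)] -/
theorem IsBlowup.toBase_of_relativeGluingData {X : Scheme.{u}} (J : X.IdealSheafData)
    (d : X.directedAffineCover.RelativeGluingData)
    (hd : ∀ U : X.affineOpens, IsBlowup (d.natTrans.app U) (J.comap (U : X.Opens).ι)) :
    IsBlowup d.toBase J := by
  refine IsBlowup.of_openCover X.directedAffineCover fun U => ?_
  change X.affineOpens at U
  have e1 : Scheme.Hom.opensRange (X.directedAffineCover.f U) = (U : X.Opens) :=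
    Scheme.Opens.opensRange_ι _
  rw [e1]
  have sq1 : IsPullback (d.natTrans.app U) (colimit.ι d.functor U) (U : X.Opens).ι d.toBase :=
    d.isPullback_natTrans_ι_toBase U
  have sq2 := isPullback_morphismRestrict d.toBase (U : X.Opens)
  have hφ : (sq1.isoIsPullback _ _ sq2).inv ≫ d.natTrans.app U = d.toBase ∣_ (U : X.Opens) :=
    sq1.isoIsPullback_inv_fst _ _ sq2
  have := (hd U).iso_comp (sq1.isoIsPullback _ _ sq2).symm
  rwa [Iso.symm_hom, hφ] at this

/-- **Existence of blowing ups** (Görtz–Wedhorn I, Prop. 13.92: for every scheme `X` and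
quasi-coherent ideal `𝓘`, `Proj ⨁ 𝓘^d` is a blow-up of `X` along `V(𝓘)`; Stacks 01OG/0806):
every ideal sheaf `J` on a scheme `X` has a blowing up `π : X' → X`, `IsBlowup π J`. Proof by
gluing the affine blowing ups `Bl(U) → U` of the affine opens `U ⊆ X`
(`exists_isBlowup_of_isAffine`) along the cartesian transition maps `Bl(U) → Bl(V)`, `U ⊆ V`
(`IsBlowup.isPullback_of_isOpenImmersion`), as a relative gluing datum over the locally directed
affine cover (Mathlib `Scheme.Cover.RelativeGluingData`), and checking the universal property
locally on the base (`IsBlowup.of_openCover`). [cite: GortzWedhorn2020, Prop. 13.92] -/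
theorem exists_isBlowup (X : Scheme.{u}) (J : X.IdealSheafData) :
    ∃ (X' : Scheme.{u}) (π : X' ⟶ X), IsBlowup π J := by
  classical
  -- local blowing ups of the affine opens
  have hloc : ∀ U : X.affineOpens,
      ∃ (B : Scheme.{u}) (p : B ⟶ (U : Scheme.{u})), IsBlowup p (J.comap (U : X.Opens).ι) :=
    fun U => haveI : IsAffine (U : Scheme.{u}) := U.2; exists_isBlowup_of_isAffine _ _
  choose B p hp using hloc
  -- the Cartier condition producing the transition morphisms `Bl(U) → Bl(V)` for `U ≤ V`
  have hcart : ∀ {U V : X.affineOpens} (h : U ≤ V),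
      IsEffectiveCartier ((J.comap (V : X.Opens).ι).comap (p U ≫ X.homOfLE h)) := by
    intro U V h
    rw [← Scheme.IdealSheafData.comap_comp, Category.assoc, Scheme.homOfLE_ι,
      Scheme.IdealSheafData.comap_comp]
    exact (hp U).isEffectiveCartier
  let 𝒰 := X.directedAffineCover
  -- the functor of local blowing ups over the locally directed affine cover
  let F : 𝒰.I₀ ⥤ Scheme.{u} :=
    { obj := fun U => B U
      map := fun {U V} f => (hp V).lift (p U ≫ X.homOfLE f.le) (hcart f.le)
      map_id := fun U => by
        refine (hp U).hom_ext ?_ ?_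
        · rw [(hp U).lift_comp]; exact hcart le_rfl
        · rw [(hp U).lift_comp, Category.id_comp, Scheme.homOfLE_rfl, Category.comp_id]
      map_comp := fun {U V W} f g => by
        refine (hp W).hom_ext ?_ ?_
        · rw [(hp W).lift_comp]; exact hcart _
        · rw [(hp W).lift_comp, Category.assoc, (hp W).lift_comp, ← Category.assoc,
            (hp V).lift_comp, Category.assoc, Scheme.homOfLE_homOfLE] }
  -- the structure maps, a cartesian natural transformation
  let α : F ⟶ 𝒰.functorOfLocallyDirected :=
    { app := fun U => p U
      naturality := fun {U V} f => by
        change (hp V).lift (p U ≫ X.homOfLE f.le) (hcart f.le) ≫ p V = p U ≫ X.homOfLE f.le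
        rw [(hp V).lift_comp] }
  have hα : NatTrans.Equifibered α := by
    intro U V f
    change IsPullback ((hp V).lift (p U ≫ X.homOfLE f.le) (hcart f.le)) (p U) (p V)
      (X.homOfLE f.le)
    refine (hp V).isPullback_of_isOpenImmersion (X.homOfLE f.le) ?_ ((hp V).lift_comp _ _)
    rw [← Scheme.IdealSheafData.comap_comp, Scheme.homOfLE_ι]
    exact hp U
  let d : 𝒰.RelativeGluingData := ⟨F, α, hα⟩
  -- the glued scheme is a blowing up (checked over each affine open)
  exact ⟨d.glued, d.toBase, IsBlowup.toBase_of_relativeGluingData J d fun U => hp U⟩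

/-- **`Stacks01OG` holds**: every ideal sheaf on every scheme has a blowing up (`exists_isBlowup`).
[cite: StacksProject, Tag 01OG and Tag 0806; GortzWedhorn2020, Prop. 13.92] -/
theorem stacks01OG_holds : Stacks01OG.{u} :=
  fun X J => exists_isBlowup X J

/-- **`Stacks01OG` holds** — the discharge under the conventional name `Stacks01OG_holds` (the
`X_holds` convention for the named fact `Stacks01OG`; same term as `stacks01OG_holds`).
[cite: StacksProject, Tag 01OG and Tag 0806; GortzWedhorn2020, Prop. 13.92] -/
theorem Stacks01OG_holds : Stacks01OG.{u} :=
  stacks01OG_holds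

end Literature.AlgebraicGeometry.Resolution

end
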